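import Literature.Computability.AlgebraicComplexity.BI17HoweInvariantsProofs
import HarnessLib

/-!
# Bürgisser–Ikenmeyer 2017, Cor. 3.16 (`e(D,m) = m` for even `D`) — discharge

P. Bürgisser, C. Ikenmeyer, *Fundamental invariants of orbit closures*, J. Algebra **477** (2017)
390–434 = arXiv:1511.02927 [BurgisserIkenmeyer2017], §3.2 (`main.tex` L1114–1163; held text
`paper:arxiv-1511.02927`, p0010–p0011). Theorem-only companion of the file of record
`BI17FundamentalInvariantForms.lean` (val-lit row BI17-A, t04), which types Thm. 3.14 (Howe) and
Cor. 3.16 as the named facts `BI2017_thm_3_14`, `BI2017_cor_3_16`.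

* `mem_genericDegreeMonoid_self_of_even`, `genericMinimalDegree_le_self_of_even` — `m ∈ E(D,m)`
  and `e(D,m) ≤ m` for even `D ≥ 2`, `m ≥ 2`, witnessed by Cayley's `P_{D,m}`: nonzero (Thm. 3.18(2),
  `BI2017_thm_3_18_2`), homogeneous of degree `m` and `SL_m`-invariant (Thm. 3.18(1); the tree's
  `cayleyP_mem_slInvariantsOfDegree`, `BI17HoweInvariantsProofs.lean`) — the half of Cor. 3.16 that
  does not need Howe's theorem.
* `BI2017_cor_3_16_of_thm_3_14` — **Cor. 3.16 ⇐ Thm. 3.14**: the printed derivation ("an immediate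
  consequence", L1157: no nonzero invariant in degrees `0 < d < m` by Howe, and `P_{D,m} ≠ 0` in
  degree `m`), with the degenerate ranges `m = 0` (`genericMinimalDegree_fin_zero`: no positive degree
  occurs) and `m = 1` (`genericMinimalDegree_fin_one`: `SL_1 = 1`, the coordinate `X_{x^D}` has degree
  `1`) of the typed statement done by hand (Thm. 3.14 is typed for `m ≥ 2`).
* `BI2017_cor_3_16_holds` — **Cor. 3.16 DISCHARGED**, feeding the bridge with the tree's
  `BI2017_thm_3_14_holds` (Howe's theorem, discharged in `BI17HoweInvariantsProofs.lean`, val-lit t01).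

No new definitions; no facts introduced. Honest framing: proofs of published statements about
invariants of forms; nothing here bears on VP versus VNP.

## References

* [BurgisserIkenmeyer2017] P. Bürgisser, C. Ikenmeyer, *Fundamental invariants of orbit closures*,
  J. Algebra 477 (2017) 390–434; arXiv:1511.02927, §3.2 Thm. 3.14, Cor. 3.16, Thm. 3.18.
-/

open MvPolynomial

namespace Literature.Computability.AlgebraicComplexity

section GenericMinimalDegree

variable {m D : ℕ}

/-- For even `D ≥ 2` and `m ≥ 2`, the degree `m` lies in the generic degree monoid `E(D,m)`,
witnessed by `P_{D,m}` (nonzero by Thm. 3.18(2), homogeneous of degree `m`, `SL_m`-invariant by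
Thm. 3.18(1) — the tree's `cayleyP_mem_slInvariantsOfDegree`). [cite: BurgisserIkenmeyer2017, Thm. 3.18] -/
theorem mem_genericDegreeMonoid_self_of_even (hD : Even D) (hD0 : 0 < D) (hm : 2 ≤ m) :
    m ∈ genericDegreeMonoid (Fin m) ℂ D :=
  ⟨cayleyP (k := ℂ) D (Equiv.refl (Fin m)), isHomogeneous_hyperdetPoly _,
    ((mem_slInvariantsOfDegree_iff D m _).mp (cayleyP_mem_slInvariantsOfDegree (k := ℂ) m D)).2,
    (BI2017_thm_3_18_2 (k := ℂ) hm hD0 (Equiv.refl (Fin m))).mpr hD⟩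

/-- Hence `e(D,m) ≤ m` for even `D ≥ 2`, `m ≥ 2` (the half of Cor. 3.16 that does not need Howe's
theorem). [cite: BurgisserIkenmeyer2017, Cor. 3.16] -/
theorem genericMinimalDegree_le_self_of_even (hD : Even D) (hD0 : 0 < D) (hm : 2 ≤ m) :
    genericMinimalDegree (Fin m) ℂ D ≤ m :=
  Nat.sInf_le ⟨mem_genericDegreeMonoid_self_of_even hD hD0 hm, by omega⟩

/-- In no variables (`m = 0`) there is no nonzero homogeneous polynomial function of positive degree
on `Sym^D`, `D ≥ 1`: `E(D,0) ∩ ℕ_{>0} = ∅`, so `e(D,0) = 0`. [cite: BurgisserIkenmeyer2017, Def. 3.6] -/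
theorem genericMinimalDegree_fin_zero (hD0 : 0 < D) : genericMinimalDegree (Fin 0) ℂ D = 0 := by
  have hempty : IsEmpty (DegIdx (Fin 0) D) := by
    refine ⟨fun d => ?_⟩
    have hd := mem_degMonomials_iff.mp d.2
    have h0 : (d : Fin 0 →₀ ℕ) = 0 := Subsingleton.elim _ _
    rw [h0, map_zero] at hd
    omega
  have hS : {d | d ∈ genericDegreeMonoid (Fin 0) ℂ D ∧ 0 < d} = ∅ := by
    ext d
    simp only [Set.mem_setOf_eq, Set.mem_empty_iff_false, iff_false, not_and, not_lt]
    rintro ⟨F, hFd, -, hF0⟩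
    have hF : F = C (F.coeff 0) := eq_C_of_isEmpty F
    have hd0 : d = 0 := by
      have h0 : F.IsHomogeneous 0 := by rw [hF]; exact isHomogeneous_C _ _
      exact hFd.inj_right h0 hF0
    omega
  rw [genericMinimalDegree, hS, Nat.sInf_empty]

/-- In one variable (`m = 1`), `SL_1 = {1}` and every polynomial function is invariant; the
coordinate `X_{x^D}` has degree `1`, so `e(D,1) = 1`. [cite: BurgisserIkenmeyer2017, Def. 3.6] -/
theorem genericMinimalDegree_fin_one (D : ℕ) : genericMinimalDegree (Fin 1) ℂ D = 1 := by
  -- `SL (Fin 1) ℂ` is trivial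
  have hSL : ∀ g : Matrix.SpecialLinearGroup (Fin 1) ℂ, g = 1 := by
    intro g
    ext i j
    have hi : i = 0 := Subsingleton.elim _ _
    have hj : j = 0 := Subsingleton.elim _ _
    subst hi hj
    have h := g.prop
    rw [Matrix.det_fin_one] at h
    simpa using h
  -- the coordinate of `x^D`
  let d : DegIdx (Fin 1) D := ⟨Finsupp.single 0 D, mem_degMonomials_iff.mpr (by simp)⟩
  have h1 : 1 ∈ {d | d ∈ genericDegreeMonoid (Fin 1) ℂ D ∧ 0 < d} := by
    refine ⟨⟨X d, isHomogeneous_X _ _, fun g => ?_, X_ne_zero _⟩, Nat.one_pos⟩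
    rw [hSL g, map_one, coordRep_apply, coordSubst_one]
    rfl
  refine le_antisymm (Nat.sInf_le h1) ?_
  exact le_csInf ⟨1, h1⟩ fun d hd => hd.2

/-- **BI 2017, Cor. 3.16 from Howe's Thm. 3.14**: `e(D,m) = m` for even `D ≥ 2`. For `m ≥ 2`:
`≤` by `P_{D,m}` (Thm. 3.18), `≥` because `O(Sym^D ℂ^m)^{SL_m}_d = 0` for `0 < d < m` (Thm. 3.14,
the hypothesis); `m = 0, 1` directly. [cite: BurgisserIkenmeyer2017, Cor. 3.16] -/
theorem BI2017_cor_3_16_of_thm_3_14 (h : BI2017_thm_3_14) : BI2017_cor_3_16 := by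
  intro D m hD hD0
  rcases Nat.lt_or_ge m 2 with hm | hm
  · interval_cases m
    · exact genericMinimalDegree_fin_zero hD0
    · exact genericMinimalDegree_fin_one D
  · have hmem : m ∈ {d | d ∈ genericDegreeMonoid (Fin m) ℂ D ∧ 0 < d} :=
      ⟨mem_genericDegreeMonoid_self_of_even hD hD0 hm, by omega⟩
    refine le_antisymm (Nat.sInf_le hmem) (le_csInf ⟨m, hmem⟩ ?_)
    rintro d ⟨⟨F, hFd, hFi, hF0⟩, hd⟩
    by_contra hlt
    have hbot := (h D m hD0 hm).1 d hd (not_le.mp hlt)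
    have hF : F ∈ slInvariantsOfDegree (Fin m) ℂ D d :=
      (mem_slInvariantsOfDegree_iff D d F).mpr ⟨hFd, hFi⟩
    rw [hbot, Submodule.mem_bot] at hF
    exact hF0 hF

/-- **BI 2017, Cor. 3.16 — DISCHARGED** (L1160–1163): "If `D` is even, then the generic minimal degree
is given by `e(D,m) = m`." The bridge `BI2017_cor_3_16_of_thm_3_14` fed with Howe's theorem
`BI2017_thm_3_14_holds` (tree, `BI17HoweInvariantsProofs.lean`). [cite: BurgisserIkenmeyer2017, Cor. 3.16] -/
theorem BI2017_cor_3_16_holds : BI2017_cor_3_16 :=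
  BI2017_cor_3_16_of_thm_3_14 BI2017_thm_3_14_holds

end GenericMinimalDegree

end Literature.Computability.AlgebraicComplexity
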